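import Summits.CriticalPhenomena.CardyFormulaZ2.Theorems.CardyQContinuationUniformZeroFreeJetsEnvelope
import Literature.NumberTheory.LFunctions.XiTaylor

/-!
# Real jets of the crossing ratio (crux `UniformZeroFree`, stmt-CriticalPhenomena-5559)

Notation of the route `CardyQContinuation`: for a conformal rectangle `R`, mesh `δ` and complex
`s`, `Z_δ(s) = Σ_{ω ⊆ E(Ω_δ)} s^(|ω| + 2 k_B(ω))` is the self-dual arc partition function,
`N_δ(s)` its crossing-restricted part and `P_δ = N_δ/Z_δ` the crossing ratio.  The registered stub
`stub_jetsBounded` of the line `birth` (v2) bounds the jets `P_δ^{(k)}(t)` at REAL points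
`t ∈ [1, √2]`, uniformly in `δ`.  This file records the elementary reflection symmetry behind the
"conditional cumulant" reading of these jets:

* `jets_iteratedDeriv_ofReal_im` — if `f (s̄) = conj (f s)` for all `s`, the same holds for
  every iterated derivative (the tree's `Literature.NumberTheory.LFunctions.iteratedDeriv_conj_of_conj`,
  from Mathlib's unconditional `deriv_conj_conj`), hence all jets of such an `f` at real points
  are real;
* `jets_ratio_finset_conj` — a ratio of (restricted) sums of monomials `Σ 𝟙_C s^{m} / Σ s^{m}`
  has this symmetry (natural-number exponents, real coefficients);
* `jets_conj`, `jets_im_eq_zero` — for `δ > 0` (finitely many configurations,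
  `finite_powerset_edgeSet`): `P_δ^{(k)}(s̄) = conj P_δ^{(k)}(s)` for every complex `s` and every
  `k`, and `Im P_δ^{(k)}(t) = 0` at every real `t` — the jets the stub bounds are real numbers
  (differences of conditional cumulants of `L = |ω| + 2k_B` under the real FK measures `φ_t`).

Statements about the route's objects are written on the `dsimp only`-normal form of the route's
`let w; let Z; let N` bindings, as the stub is registered.
-/

namespace Summit.CriticalPhenomena.CardyFormulaZ2.Theorems.UniformZeroFree

open scoped ComplexConjugate
open Summit.CriticalPhenomena.CardyFormulaZ2.Theorems.CardyQContinuation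

/-- **Jets at real points are real.** If `f (s̄) = conj (f s)` for every `s`, then
`Im f^{(n)}(x) = 0` at every real `x`. [folklore] -/
theorem jets_iteratedDeriv_ofReal_im {f : ℂ → ℂ} (hf : ∀ s, f (conj s) = conj (f s)) (n : ℕ)
    (x : ℝ) : (iteratedDeriv n f x).im = 0 := by
  have h := Literature.NumberTheory.LFunctions.iteratedDeriv_conj_of_conj hf n x
  rw [Complex.conj_ofReal] at h
  exact Complex.conj_eq_iff_im.1 h.symm

/-- **Reflection symmetry of a ratio of monomial sums.** For a finite index set `F`, an event `C`
and exponents `m : α → ℕ`, the ratio `P(s) = (Σ_F 𝟙_C s^{m a}) / (Σ_F s^{m a})` satisfies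
`P(s̄) = conj P(s)` (real — indeed natural — coefficients). [folklore] -/
theorem jets_ratio_finset_conj {α : Type*} (F : Finset α) (C : Set α) (m : α → ℕ) (s : ℂ) :
    (∑ a ∈ F, C.indicator (fun b => conj s ^ m b) a) / (∑ a ∈ F, conj s ^ m a)
      = conj ((∑ a ∈ F, C.indicator (fun b => s ^ m b) a) / ∑ a ∈ F, s ^ m a) := by
  rw [map_div₀, map_sum, map_sum]
  congr 1
  · refine Finset.sum_congr rfl fun a _ => ?_
    by_cases ha : a ∈ C
    · simp only [Set.indicator_of_mem ha, map_pow]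
    · simp only [Set.indicator_of_notMem ha, map_zero]
  · exact Finset.sum_congr rfl fun a _ => (map_pow _ _ _).symm

/-- **(J9) Reflection symmetry of the jets of `P_δ`.** For a conformal rectangle `R`, mesh `δ > 0`,
complex `s` and order `k`: `(N_δ/Z_δ)^{(k)}(s̄) = conj (N_δ/Z_δ)^{(k)}(s)` — `N_δ`, `Z_δ` are
polynomials in `s` with natural-number coefficients (finitely many configurations for `δ > 0`,
`finite_powerset_edgeSet`). [folklore] -/
theorem jets_conj : ∀ R : Literature.Probability.RandomPlanarGeometry.ConformalRectangle, ∀ δ : ℝ, 0 < δ → ∀ s : ℂ, ∀ k : ℕ, iteratedDeriv k (fun s ↦ (∑ᶠ ω ∈ 𝒫 (Literature.Probability.LatticeModels.discreteDomainGraph R.carrier δ).edgeSet, (Literature.Probability.Percolation.discreteCrossing R.carrier δ (R.arc 0) (R.arc 2)).indicator (fun ω ↦ s ^ (ω.ncard + 2 * Nat.card ((Literature.Probability.Percolation.openGraph ω ⊔ Literature.Probability.LatticeModels.wired (Literature.Probability.LatticeModels.discreteArc R.carrier δ (R.arc 0) ∪ Literature.Probability.LatticeModels.discreteArc R.carrier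 δ (R.arc 2))).induce (Literature.Probability.LatticeModels.meshDomain R.carrier δ)).ConnectedComponent)) ω) / (∑ᶠ ω ∈ 𝒫 (Literature.Probability.LatticeModels.discreteDomainGraph R.carrier δ).edgeSet, s ^ (ω.ncard + 2 * Nat.card ((Literature.Probability.Percolation.openGraph ω ⊔ Literature.Probability.LatticeModels.wired (Literature.Probability.LatticeModels.discreteArc R.carrier δ (R.arc 0) ∪ Literature.Probability.LatticeModels.discreteArc R.carrier δ (R.arc 2))).induce (Literature.Probability.LatticeModels.meshDomain R.carrier δ)).ConnectedComponent))) ((starRingEnd ℂ) s) = (starRingEnd ℂ) (iteratedDeriv k (fun s ↦ (∑ᶠ ω ∈ 𝒫 (Literature.Probability.LatticeModels.discreteDomainGraph R.carrier δ).edgeSet, (Literature.Probability.Percolation.discreteCrossing R.carrier δ (R.arc 0) (R.arc 2)).indicator (fun ω ↦ s ^ (ω.ncard + 2 * Nat.card ((Literature.Probability.Percolation.openGraph ω ⊔ Literature.Probability.LatticeModels.wired (Literature.Probability.LatticeModels.discreteArc R.carrier δ (R.arc 0) ∪ Literature.Probability.LatticeModels.discreteArc R.carrier δ (R.arc 2))).induce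 (Literature.Probability.LatticeModels.meshDomain R.carrier δ)).ConnectedComponent)) ω) / (∑ᶠ ω ∈ 𝒫 (Literature.Probability.LatticeModels.discreteDomainGraph R.carrier δ).edgeSet, s ^ (ω.ncard + 2 * Nat.card ((Literature.Probability.Percolation.openGraph ω ⊔ Literature.Probability.LatticeModels.wired (Literature.Probability.LatticeModels.discreteArc R.carrier δ (R.arc 0) ∪ Literature.Probability.LatticeModels.discreteArc R.carrier δ (R.arc 2))).induce (Literature.Probability.LatticeModels.meshDomain R.carrier δ)).ConnectedComponent))) s) := by
  intro R δ hδ s k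
  have hfin := finite_powerset_edgeSet R.isBounded hδ
  simp only [finsum_mem_eq_finite_toFinset_sum _ hfin]
  exact Literature.NumberTheory.LFunctions.iteratedDeriv_conj_of_conj
    (fun z => jets_ratio_finset_conj _ _ _ z) k s

/-- **(J9') The jets bounded by `stub_jetsBounded` are real.** For a conformal rectangle `R`, mesh
`δ > 0`, real `t` and order `k`: `Im (N_δ/Z_δ)^{(k)}(t) = 0`.  (At `t > 0` these real numbers are
`k!` times the Taylor coefficients of the crossing ratio, i.e. polynomial combinations of joint
cumulants of `𝟙_{C_δ}` and `L = |ω| + 2k_B` under the self-dual FK measure `φ_t`; the stub asks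
for `|P_δ^{(k)}(t)| ≤ M · k! · A^k` uniformly in `δ`.) [folklore] -/
theorem jets_im_eq_zero : ∀ R : Literature.Probability.RandomPlanarGeometry.ConformalRectangle, ∀ δ : ℝ, 0 < δ → ∀ t : ℝ, ∀ k : ℕ, (iteratedDeriv k (fun s ↦ (∑ᶠ ω ∈ 𝒫 (Literature.Probability.LatticeModels.discreteDomainGraph R.carrier δ).edgeSet, (Literature.Probability.Percolation.discreteCrossing R.carrier δ (R.arc 0) (R.arc 2)).indicator (fun ω ↦ s ^ (ω.ncard + 2 * Nat.card ((Literature.Probability.Percolation.openGraph ω ⊔ Literature.Probability.LatticeModels.wired (Literature.Probability.LatticeModels.discreteArc R.carrier δ (R.arc 0) ∪ Literature.Probability.LatticeModels.discreteArc R.carrier δ (R.arc 2))).induce (Literature.Probability.LatticeModels.meshDomain R.carrier δ)).ConnectedComponent)) ω) / (∑ᶠ ω ∈ 𝒫 (Literature.Probability.LatticeModels.discreteDomainGraph R.carrier δ).edgeSet, s ^ (ω.ncard + 2 * Nat.card ((Literature.Probability.Percolation.openGraph ω ⊔ Literature.Probability.LatticeModels.wired (Literature.Probability.LatticeModels.discreteArc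 R.carrier δ (R.arc 0) ∪ Literature.Probability.LatticeModels.discreteArc R.carrier δ (R.arc 2))).induce (Literature.Probability.LatticeModels.meshDomain R.carrier δ)).ConnectedComponent))) (t : ℂ)).im = 0 := by
  intro R δ hδ t k
  have hfin := finite_powerset_edgeSet R.isBounded hδ
  simp only [finsum_mem_eq_finite_toFinset_sum _ hfin]
  exact jets_iteratedDeriv_ofReal_im (fun z => jets_ratio_finset_conj _ _ _ z) k t

end Summit.CriticalPhenomena.CardyFormulaZ2.Theorems.UniformZeroFree
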